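import Summits.HodgeConjecture.HodgeConjecture.Theorems.VHCAbelianSchemesRoadWeilLineAnchors
import Summits.HodgeConjecture.HodgeConjecture.Theorems.VHCAbelianSchemesRoadWeilLineKodairaGlue
import Summits.HodgeConjecture.HodgeConjecture.Theorems.Ring2AbelianAllSplitWeilClassesDefs
import Summits.HodgeConjecture.HodgeConjecture.Theorems.Ring2DeformCompactPencils
import Summits.HodgeConjecture.HodgeConjecture.Theses.VHCAbelianSchemesRoad
import HarnessLib

/-!
# Ring 2 / AbelianAll (André column) — `HC_CM`, the split Weil classes of every CM field, and `HC_AV` (with `HC_CM` idle) FROM ONE CARRIED `E`-WEIL CLASS PER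
# TENSOR STRUCTURE OVER ONE ELLIPTIC CURVE — the rows of PART AD-II on the cell's named decls (leaf file)

research route, not a corollary; conditional on HC_CM plus one named minimal statement.

LEAF FILE (imports route files; nothing should import it). PART AD-II: André's `E`-LINE of Weil sections (Literature `andre1996_splitWeilClasses_weilLinePencil`,
`andre1996_cmHodgeClasses_weilLinePencils`; statement only) + the one-class lemma shrink the Weil-tensor node of PARTS AC-f / AD from «a carrier for EVERY rational
`E`-Weil class of every CM-field structure on the polarised abelian varieties isogenous to powers of `E₀`» to «ONE carried non-zero rational `E`-Weil class per
structure and polarisation, at structures exhibiting a non-zero rational `(p,p)` Weil witness» — the GUARDED node `OneTensorWeilHodgeClassCarriers 𝒪 E₀` /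
`OneTensorWeilHodgeClassTwistedCarriers E₀` (PART AD-II Defs §2; the unguarded §1 node over-asks at CM `E₀` and is only related by lattice here). Rows:

* §1 **`andreSplitWeilClasses_of_oneTensorWeilHodgeClassTwistedCarriers : K-C → TwistedPerfectDoor → andre1996_splitWeilClasses_weilLinePencil → E₀.dim = 1 →
  OneTensorWeilHodgeClassTwistedCarriers E₀ → AndreSplitWeilClasses`** (door-generic form first);
* §2 **`HC_CM_of_oneTensorWeilHodgeClassTwistedCarriers : K-C → TwistedPerfectDoor → andre1996_cmHodgeClasses_weilLinePencils → E₀.dim = 1 →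
  OneTensorWeilHodgeClassTwistedCarriers E₀ → HC_CM`**, and both at once;
* §3 **`HC_AV_of_cmAlgebraic_and_oneTensorWeilHodgeClass_twistedCarriers : K-C → TwistedPerfectDoor → AndreCMAnchoredPencil → andre1996_cmHodgeClasses_weilLinePencils →
  CMAlgebraicTwistedCarriers → E₀.dim = 1 → OneTensorWeilHodgeClassTwistedCarriers E₀ → HC_AV`** — THE ANDRÉ COLUMN'S `B_min` OF GEN 61 (`HC_CM` IDLE): twisted
  carriers, modulo the `θ`-ray, for KNOWN ALGEBRAIC classes at CM anchors (`2 ≤ p`, `2p + 4 ≤ n`) and ONE carried non-zero rational `E`-Weil class per CM-field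
  structure (with a Hodge witness) and polarisation on the abelian varieties isogenous to powers of ONE elliptic curve (`2 ≤ p ≤ n − 2`);
* §4 lattice on the named nodes: `EllipticTensorWeilTwistedCarriers E₀ ⟹` guarded node, unguarded `⟹` guarded, `EllipticPowerAlgebraicTwistedCarriers ⟹`,
  `AbelianTwistedDesigns ⟹`; so §§1–3 REFINE the rows of AC-f / AD-b granted the line facts;
* §5 the CM line fact discharges the road's binder #22 (the line ⟹ tensor projections are AD-d §0).
* §6 (appended) WITH KODAIRA, ONE ANDRÉ FACT: Lemme 6.3.2 is a theorem of the tree (CorCM), so `HC_CM`, both axes and `B_min` need only Lemme 6.3.3 ALONE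
  (line form), Kodaira's embedding theorem, the door and the guarded one-class node — `HC_AV_of_kodaira_of_cmAlgebraic_and_oneTensorWeilHodgeClass_twistedCarriers`.
* §7 (appended) THE SMALLEST OPEN INSTANCE, argument-free: `QuarticTensorEightfoldOneTwistedCarrier` (Defs §3: ONE carried codimension-2 Weil class per quartic
  CM-field structure on the eightfolds isogenous to `E₀⁸`, some `E₀`) ∧ K-C ∧ door ∧ Lemme 6.3.3 alone (line form) ⟹ the codimension-2 Weil classes of EVERY split
  quartic-CM Weil eightfold (`weilClassesField_le_algebraicClasses_quarticSplitEightfold_of_quarticTensorEightfoldOneTwistedCarrier`).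

HONEST: every carrier node is OPEN, not in print, NOT implied by the Hodge conjecture; the line facts are THEOREMS IN PRINT entering BY NAME (from the proof of
Lemme 6.3.3: «NOT recorded» lists in the Literature module); Lemme 6.3.1 and the door are the road's binders (labels: route file; `bfSingleAdmissible` disjunct
print-supported for `B₀ = 0` or initial-segment degree sets, RING2-MAP AA2.487). Nothing here says any carrier, door, Weil class, `HC_CM`, `HC_AV` or HC holds.
References: [cite: Andre1996Motifs, §6.3 a)–c), Lemmes 6.3.1–6.3.3 and proof of 6.3.3 (pp. 31–33)] [cite: MoonenZarhin1998WeilClasses, §1] [cite: Markman2025SurveySecant, §4]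
[cite: Bloch1972Semiregularity, Remark (7.5)] [cite: BuchweitzFlenner2003, §5 Thm. 5.1] [cite: Pridham2024Semiregularity, Cor. 2.25 and Rem. 2.26–2.27]
[cite: Milne1999, §7 p. 72].
-/

noncomputable section

open CategoryTheory CategoryTheory.Limits AlgebraicGeometry Topology

namespace Summit.HodgeConjecture.HodgeConjecture.Ring2.AbelianAll

-- the cell's namespace repeats the summit name (`Summit.HodgeConjecture.HodgeConjecture…`), as in every `Ring2*` file
set_option linter.dupNamespace false

open Literature.AlgebraicGeometry Literature.AlgebraicGeometry.Motives
open Literature.AlgebraicGeometry.HodgeTheory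
open Literature.AlgebraicGeometry.Deligne1982
open Literature.AlgebraicGeometry.VanGeemen1994 (pullbackOne)
open Literature.AlgebraicTopology.SingularHomology
open Literature.AlgebraicGeometry.Milne1999 (IsOfCMType CMHodgeHypothesisAt)
open Literature.AlgebraicGeometry.Andre1996 (andre1996_cmAnchoredPencil andre1996_cmHodgeClasses_weilTensorPencils andre1996_splitWeilClasses_weilTensorPencil
  andre1996_splitWeilClasses_weilLinePencil andre1996_cmHodgeClasses_weilLinePencils)
open Summit.Ventures.HSemireg (ObjClass LocalVariationalHodgeFor)
open Summit.HodgeConjecture.HodgeConjecture.Theses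
open Summit.HodgeConjecture.HodgeConjecture.Ring2.SemiregularRepresentatives (AnchoredCarrierAt
  twistedPerfectDoorVHC_iff_localVariationalHodgeFor weilTensorCarrierAt_of_ellipticPowerAlgebraicCarrierAt ellipticPowerAlgebraicCarrierAt_of_pinnedDesignAt
  splitWeilClass_mem_algebraicClasses_of_weilLinePencil_of_door_of_oneTensorWeilHodgeClassCarriers
  cmHodgeHypothesisAt_of_weilLinePencils_of_door_of_oneTensorWeilHodgeClassCarriers
  forall_hodgeConjectureFor_of_andre1996_of_weilLinePencils_of_door_of_cmAlgebraic_of_oneCarried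
  oneTensorWeilHodgeClassCarriers_of_ellipticTensorWeilCarriers oneTensorWeilHodgeClassCarriers_of_oneTensorWeilClassCarriers
  andre1996_splitWeilClasses_weilTensorPencil_of_weilLinePencil andre1996_cmHodgeClasses_weilTensorPencils_of_weilLinePencils
  andre1996_cmHodgeClasses_algebraicallyAnchoredPencils_of_weilTensorPencils)

/-! ## §1 `AndreSplitWeilClasses` from one carried class per tensor structure -/

/-- **Split `E`-Weil classes, every CM field, from the split LINE fact, the door's local variational Hodge statement and ONE CARRIED `E`-WEIL CLASS PER TENSOR
STRUCTURE OVER ONE ELLIPTIC CURVE** (door-generic; no CM hypothesis; `HC_CM` absent). [cite: Andre1996Motifs, §6.3 a), Lemme 6.3.3 and proof (pp. 32–33)]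
[cite: MoonenZarhin1998WeilClasses, §1] [cite: Markman2025SurveySecant, §4] -/
theorem andreSplitWeilClasses_of_weilLinePencil_of_door_of_oneTensorWeilHodgeClassCarriers (h : andre1996_splitWeilClasses_weilLinePencil) {𝒪 : ObjClass}
    (hT : LocalVariationalHodgeFor 𝒪) {E₀ : AbelianVariety ℂ} (hE₀ : E₀.dim = 1) (hone : OneTensorWeilHodgeClassCarriers 𝒪 E₀) : AndreSplitWeilClasses :=
  fun _ _ _ _ _ _ _ hB ha ha₀ hRos hsplit _ hw hwQ ↦
    splitWeilClass_mem_algebraicClasses_of_weilLinePencil_of_door_of_oneTensorWeilHodgeClassCarriers h hT hE₀ hone hB ha ha₀ hRos hsplit hw hwQ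

/-- **`AndreSplitWeilClasses ⟸ K-C ∧ TwistedPerfectDoor ∧ andre1996_splitWeilClasses_weilLinePencil ∧ (ONE elliptic curve E₀) ∧ OneTensorWeilHodgeClassTwistedCarriers E₀`**:
the Weil classes of EVERY split `E`-Weil structure, EVERY CM field, from ONE semiregular twisted representative (modulo the `θ`-ray) of ONE non-zero rational
`E`-Weil class per CM-field structure and polarisation on the abelian varieties isogenous to powers of ONE elliptic curve of our choice.
[cite: Andre1996Motifs, §6.3 a), Lemme 6.3.3 and proof (pp. 32–33)] [cite: Pridham2024Semiregularity, Cor. 2.25 and Rem. 2.26–2.27] [cite: Markman2025SurveySecant, §4] -/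
theorem andreSplitWeilClasses_of_oneTensorWeilHodgeClassTwistedCarriers (hC : VHCAbelianSchemesRoad.ChernCharacterOnBetti)
    (hDoor : VHCAbelianSchemesRoad.TwistedPerfectDoor) (h : andre1996_splitWeilClasses_weilLinePencil) {E₀ : AbelianVariety ℂ} (hE₀ : E₀.dim = 1)
    (hone : OneTensorWeilHodgeClassTwistedCarriers E₀) : AndreSplitWeilClasses := by
  obtain ⟨C⟩ := (hC : Nonempty ChernCharacterBetti)
  exact andreSplitWeilClasses_of_weilLinePencil_of_door_of_oneTensorWeilHodgeClassCarriers h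
    ((twistedPerfectDoorVHC_iff_localVariationalHodgeFor C _).1 (hDoor C)) hE₀ (hone C)

/-! ## §2 `HC_CM` from one carried class per tensor structure -/

/-- **`HC_CM` from the CM LINE fact, the door and ONE CARRIED `E`-WEIL CLASS PER TENSOR STRUCTURE OVER ONE ELLIPTIC CURVE** (door-generic).
[cite: Andre1996Motifs, §6.3 Lemmes 6.3.2–6.3.3 and proof (pp. 32–33)] [cite: MoonenZarhin1998WeilClasses, §1] [cite: Milne1999, §7 p. 72] -/
theorem HC_CM_of_weilLinePencils_of_door_of_oneTensorWeilHodgeClassCarriers (h₂₂ : andre1996_cmHodgeClasses_weilLinePencils) {𝒪 : ObjClass}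
    (hT : LocalVariationalHodgeFor 𝒪) {E₀ : AbelianVariety ℂ} (hE₀ : E₀.dim = 1) (hone : OneTensorWeilHodgeClassCarriers 𝒪 E₀) :
    RankFourFaces.CMAbelianHodge :=
  fun B hB' hcm ↦ cmHodgeHypothesisAt_of_weilLinePencils_of_door_of_oneTensorWeilHodgeClassCarriers h₂₂ hT hE₀ hone B hB' hcm

/-- **`HC_CM ⟸ K-C ∧ TwistedPerfectDoor ∧ andre1996_cmHodgeClasses_weilLinePencils ∧ (ONE elliptic curve E₀) ∧ OneTensorWeilHodgeClassTwistedCarriers E₀`**: the Hodge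
conjecture for CM abelian varieties from ONE semiregular twisted representative, modulo the `θ`-ray, of ONE non-zero rational `E`-Weil class per CM-field structure
(with a Hodge witness) and polarisation on the abelian varieties isogenous to powers of ONE elliptic curve of our choice.
[cite: Andre1996Motifs, §6.3 Lemmes 6.3.2–6.3.3 and proof (pp. 32–33)] [cite: Pridham2024Semiregularity, Cor. 2.25 and Rem. 2.26–2.27] [cite: Milne1999, §7 p. 72] -/
theorem HC_CM_of_oneTensorWeilHodgeClassTwistedCarriers (hC : VHCAbelianSchemesRoad.ChernCharacterOnBetti) (hDoor : VHCAbelianSchemesRoad.TwistedPerfectDoor)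
    (h₂₂ : andre1996_cmHodgeClasses_weilLinePencils) {E₀ : AbelianVariety ℂ} (hE₀ : E₀.dim = 1) (hone : OneTensorWeilHodgeClassTwistedCarriers E₀) :
    RankFourFaces.CMAbelianHodge := by
  obtain ⟨C⟩ := (hC : Nonempty ChernCharacterBetti)
  exact HC_CM_of_weilLinePencils_of_door_of_oneTensorWeilHodgeClassCarriers h₂₂ ((twistedPerfectDoorVHC_iff_localVariationalHodgeFor C _).1 (hDoor C)) hE₀ (hone C)

/-- **ONE node, TWO axes (line form)**: K-C ∧ door ∧ the two LINE facts ∧ `OneTensorWeilHodgeClassTwistedCarriers E₀` ⟹ `HC_CM ∧ AndreSplitWeilClasses`.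
[cite: Andre1996Motifs, §6.3 (pp. 31–33)] [cite: Bloch1972Semiregularity, Remark (7.5)] -/
theorem HC_CM_and_andreSplitWeilClasses_of_oneTensorWeilHodgeClassTwistedCarriers (hC : VHCAbelianSchemesRoad.ChernCharacterOnBetti)
    (hDoor : VHCAbelianSchemesRoad.TwistedPerfectDoor) (h₂₂ : andre1996_cmHodgeClasses_weilLinePencils) (h₃₃ : andre1996_splitWeilClasses_weilLinePencil)
    {E₀ : AbelianVariety ℂ} (hE₀ : E₀.dim = 1) (hone : OneTensorWeilHodgeClassTwistedCarriers E₀) : RankFourFaces.CMAbelianHodge ∧ AndreSplitWeilClasses :=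
  ⟨HC_CM_of_oneTensorWeilHodgeClassTwistedCarriers hC hDoor h₂₂ hE₀ hone, andreSplitWeilClasses_of_oneTensorWeilHodgeClassTwistedCarriers hC hDoor h₃₃ hE₀ hone⟩

/-! ## §3 `HC_AV` with `HC_CM` idle — the André column's `B_min` of gen 61 -/

/-- **`HC_AV` from Lemme 6.3.1, the CM LINE fact, the door, CM-algebraic carriers and one carried Weil class per tensor structure over one elliptic curve** (door-generic).
[cite: Andre1996Motifs, §6.3 Lemmes 6.3.1–6.3.3 (pp. 31–33)] [cite: Bloch1972Semiregularity, Remark (7.5)] -/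
theorem HC_AV_of_andre1996_of_door_of_cmAlgebraic_of_oneTensorWeilHodgeClassCarriers (h₂₁ : andre1996_cmAnchoredPencil)
    (h₂₂ : andre1996_cmHodgeClasses_weilLinePencils) {𝒪 : ObjClass} (hT : LocalVariationalHodgeFor 𝒪) (hcm : CMAlgebraicCarriers 𝒪) {E₀ : AbelianVariety ℂ}
    (hE₀ : E₀.dim = 1) (hone : OneTensorWeilHodgeClassCarriers 𝒪 E₀) : PadicSemiregularLift.HodgeAbelianVarieties :=
  fun A ↦ forall_hodgeConjectureFor_of_andre1996_of_weilLinePencils_of_door_of_cmAlgebraic_of_oneCarried h₂₁ h₂₂ hT (fun n p h2 h4 ↦ hcm n p h2 h4) hE₀ hone A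

/-- **`HC_AV ⟸ K-C ∧ TwistedPerfectDoor ∧ AndreCMAnchoredPencil ∧ andre1996_cmHodgeClasses_weilLinePencils ∧ CMAlgebraicTwistedCarriers ∧ (ONE elliptic curve E₀) ∧
OneTensorWeilHodgeClassTwistedCarriers E₀`** — THE ANDRÉ COLUMN'S `B_min` OF GEN 61 (`HC_CM` IDLE): semiregular twisted representatives, modulo the `θ`-ray, of KNOWN
ALGEBRAIC classes (i) of codimension `2 ≤ p`, `2p + 4 ≤ n` on polarised CM abelian `n`-folds and (ii) of ONE non-zero rational `E`-Weil class per CM-field structure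
(exhibiting a Hodge witness) and polarisation, codimension `2 ≤ p ≤ n − 2`, on the polarised abelian `n`-folds isogenous to powers of ONE elliptic curve `E₀` of our
choice. No cell of K-SR♭∃; no curve residual. [cite: Andre1996Motifs, §6.3 (pp. 31–33)] [cite: Pridham2024Semiregularity, Cor. 2.25 and Rem. 2.26–2.27]
[cite: MoonenZarhin1998WeilClasses, §1] [cite: Bloch1972Semiregularity, Remark (7.5)] -/
theorem HC_AV_of_cmAlgebraic_and_oneTensorWeilHodgeClass_twistedCarriers (hC : VHCAbelianSchemesRoad.ChernCharacterOnBetti)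
    (hDoor : VHCAbelianSchemesRoad.TwistedPerfectDoor) (h₂₁ : VHCAbelianSchemesRoad.AndreCMAnchoredPencil) (h₂₂ : andre1996_cmHodgeClasses_weilLinePencils)
    (hcm : CMAlgebraicTwistedCarriers) {E₀ : AbelianVariety ℂ} (hE₀ : E₀.dim = 1) (hone : OneTensorWeilHodgeClassTwistedCarriers E₀) :
    PadicSemiregularLift.HodgeAbelianVarieties := by
  obtain ⟨C⟩ := (hC : Nonempty ChernCharacterBetti)
  exact HC_AV_of_andre1996_of_door_of_cmAlgebraic_of_oneTensorWeilHodgeClassCarriers h₂₁ h₂₂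
    ((twistedPerfectDoorVHC_iff_localVariationalHodgeFor C _).1 (hDoor C)) (hcm C) hE₀ (hone C)

/-! ## §4 Lattice on the named nodes -/

/-- `EllipticTensorWeilTwistedCarriers E₀ ⟹ OneTensorWeilHodgeClassTwistedCarriers E₀` (carry the witness). [cite: Bloch1972Semiregularity, Remark (7.5)] -/
theorem oneTensorWeilHodgeClassTwistedCarriers_of_ellipticTensorWeilTwistedCarriers {E₀ : AbelianVariety ℂ} (h : EllipticTensorWeilTwistedCarriers E₀) :
    OneTensorWeilHodgeClassTwistedCarriers E₀ :=
  fun C ↦ oneTensorWeilHodgeClassCarriers_of_ellipticTensorWeilCarriers (h C)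

/-- `OneTensorWeilClassTwistedCarriers E₀ ⟹ OneTensorWeilHodgeClassTwistedCarriers E₀` (drop the guard; the unguarded node is sane only for `E₀` without CM).
[cite: Bloch1972Semiregularity, Remark (7.5)] -/
theorem oneTensorWeilHodgeClassTwistedCarriers_of_oneTensorWeilClassTwistedCarriers {E₀ : AbelianVariety ℂ} (h : OneTensorWeilClassTwistedCarriers E₀) :
    OneTensorWeilHodgeClassTwistedCarriers E₀ :=
  fun C ↦ oneTensorWeilHodgeClassCarriers_of_oneTensorWeilClassCarriers (h C)

/-- `EllipticPowerAlgebraicTwistedCarriers ⟹ OneTensorWeilHodgeClassTwistedCarriers E₀` for every elliptic `E₀` (through the all-classes tensor node).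
[cite: vanGeemen1994HodgeAV, Lemma 3.7 and Thm. 4.3] [cite: Bloch1972Semiregularity, Remark (7.5)] -/
theorem oneTensorWeilHodgeClassTwistedCarriers_of_ellipticPowerAlgebraicTwistedCarriers {E₀ : AbelianVariety ℂ} (hE₀ : E₀.dim = 1)
    (h : EllipticPowerAlgebraicTwistedCarriers) : OneTensorWeilHodgeClassTwistedCarriers E₀ :=
  fun C ↦ oneTensorWeilHodgeClassCarriers_of_ellipticTensorWeilCarriers fun n p h2 h4 ↦ weilTensorCarrierAt_of_ellipticPowerAlgebraicCarrierAt hE₀ (h C n p h2 h4)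

/-- `AbelianTwistedDesigns ⟹ OneTensorWeilHodgeClassTwistedCarriers E₀` for every elliptic `E₀`. [cite: Bloch1972Semiregularity, Remark (7.5)] -/
theorem oneTensorWeilHodgeClassTwistedCarriers_of_abelianTwistedDesigns {E₀ : AbelianVariety ℂ} (hE₀ : E₀.dim = 1) (h : AbelianTwistedDesigns) :
    OneTensorWeilHodgeClassTwistedCarriers E₀ :=
  oneTensorWeilHodgeClassTwistedCarriers_of_ellipticPowerAlgebraicTwistedCarriers hE₀ fun C n p h2 h4 ↦
    ellipticPowerAlgebraicCarrierAt_of_pinnedDesignAt (h C n p h2 h4)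

/-- Hence `HC_AV ⟸ K-C ∧ door ∧ #21 ∧ CM line fact ∧ AbelianTwistedDesigns` factors through §3 (any elliptic curve; `CMAlgebraicTwistedCarriers ⟸ AbelianTwistedDesigns`
is PART AB's `cmAlgebraicTwistedCarriers_of_abelianTwistedDesigns`, not re-derived here — we display the CM-algebraic hypothesis).
[cite: Andre1996Motifs, §6.3 (pp. 31–33)] [cite: Bloch1972Semiregularity, Remark (7.5)] -/
theorem HC_AV_of_cmAlgebraicTwistedCarriers_of_abelianTwistedDesigns_via_oneCarried (hC : VHCAbelianSchemesRoad.ChernCharacterOnBetti)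
    (hDoor : VHCAbelianSchemesRoad.TwistedPerfectDoor) (h₂₁ : VHCAbelianSchemesRoad.AndreCMAnchoredPencil) (h₂₂ : andre1996_cmHodgeClasses_weilLinePencils)
    (hcm : CMAlgebraicTwistedCarriers) (hD : AbelianTwistedDesigns) : PadicSemiregularLift.HodgeAbelianVarieties := by
  obtain ⟨E₀, hE₀, -⟩ := exists_abelianVariety_dim_one_cupProduct_ne_zero
  exact HC_AV_of_cmAlgebraic_and_oneTensorWeilHodgeClass_twistedCarriers hC hDoor h₂₁ h₂₂ hcm hE₀
    (oneTensorWeilHodgeClassTwistedCarriers_of_abelianTwistedDesigns hE₀ hD)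

/-! ## §5 The line facts discharge the tensor facts and binder #22 -/

/-- The CM LINE fact implies the CM tensor fact, hence the road's binder #22 (`AndreAnchoredPencilsAlgebraic`). [cite: Andre1996Motifs, Lemmes 6.3.2–6.3.3 (pp. 32–33)] -/
theorem andreAnchoredPencilsAlgebraic_of_weilLinePencils (h₂₂ : andre1996_cmHodgeClasses_weilLinePencils) : VHCAbelianSchemesRoad.AndreAnchoredPencilsAlgebraic :=
  andre1996_cmHodgeClasses_algebraicallyAnchoredPencils_of_weilTensorPencils (andre1996_cmHodgeClasses_weilTensorPencils_of_weilLinePencils h₂₂)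

/-! ## §6 (appended) With Kodaira: ONE André fact (Lemme 6.3.3 alone, line form) for `HC_CM`, both axes and `B_min` -/

section Kodaira

open Summit.HodgeConjecture.HodgeConjecture.Ring2.SemiregularRepresentatives
  (cmHodgeHypothesisAt_of_kodaira_of_splitWeilLinePencil_of_door_of_oneTensorWeilHodgeClassCarriers
   forall_hodgeConjectureFor_of_kodaira_of_andre1996_of_splitWeilLinePencil_of_door_of_cmAlgebraic_of_oneCarried
   andre1996_cmHodgeClasses_weilLinePencils_of_kodaira_of_splitWeilLinePencil)

/-- **`HC_CM ⟸ K-C ∧ TwistedPerfectDoor ∧ Kodaira ∧ andre1996_splitWeilClasses_weilLinePencil ∧ (ONE elliptic curve E₀) ∧ OneTensorWeilHodgeClassTwistedCarriers E₀`** — Lemme 6.3.2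
(André 1992) is a THEOREM OF THE TREE (CorCM), so the Hodge conjecture for CM abelian varieties needs ONE André fact (6.3.3 alone, line form), Kodaira's embedding theorem, the
door, and ONE carried non-zero rational `E`-Weil class per tensor structure over one elliptic curve. [cite: Andre1996Motifs, §6.3 (pp. 32–33)] [cite: Andre1992HodgeCM, Théorème]
[cite: Huybrechts2005, Prop. 5.3.1, Cor. 5.3.3] [cite: Pridham2024Semiregularity, Cor. 2.25 and Rem. 2.26–2.27] -/
theorem HC_CM_of_kodaira_of_splitWeilLinePencil_of_oneTensorWeilHodgeClassTwistedCarriers (hC : VHCAbelianSchemesRoad.ChernCharacterOnBetti)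
    (hDoor : VHCAbelianSchemesRoad.TwistedPerfectDoor) (hK : Kodaira1954_rationalKaehlerClass_eq_hyperplaneClass)
    (h633 : andre1996_splitWeilClasses_weilLinePencil) {E₀ : AbelianVariety ℂ} (hE₀ : E₀.dim = 1) (hone : OneTensorWeilHodgeClassTwistedCarriers E₀) :
    RankFourFaces.CMAbelianHodge := by
  obtain ⟨C⟩ := (hC : Nonempty ChernCharacterBetti)
  exact fun B hB' hcm ↦ cmHodgeHypothesisAt_of_kodaira_of_splitWeilLinePencil_of_door_of_oneTensorWeilHodgeClassCarriers hK h633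
    ((twistedPerfectDoorVHC_iff_localVariationalHodgeFor C _).1 (hDoor C)) hE₀ (hone C) B hB' hcm

/-- **BOTH AXES FROM ONE ANDRÉ FACT**: K-C ∧ door ∧ Kodaira ∧ `andre1996_splitWeilClasses_weilLinePencil` ∧ `OneTensorWeilHodgeClassTwistedCarriers E₀` ⟹ `HC_CM ∧ AndreSplitWeilClasses`.
[cite: Andre1996Motifs, §6.3 (pp. 31–33)] [cite: Andre1992HodgeCM, Théorème] [cite: MoonenZarhin1998WeilClasses, §1] -/
theorem HC_CM_and_andreSplitWeilClasses_of_kodaira_of_oneTensorWeilHodgeClassTwistedCarriers (hC : VHCAbelianSchemesRoad.ChernCharacterOnBetti)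
    (hDoor : VHCAbelianSchemesRoad.TwistedPerfectDoor) (hK : Kodaira1954_rationalKaehlerClass_eq_hyperplaneClass)
    (h633 : andre1996_splitWeilClasses_weilLinePencil) {E₀ : AbelianVariety ℂ} (hE₀ : E₀.dim = 1) (hone : OneTensorWeilHodgeClassTwistedCarriers E₀) :
    RankFourFaces.CMAbelianHodge ∧ AndreSplitWeilClasses :=
  ⟨HC_CM_of_kodaira_of_splitWeilLinePencil_of_oneTensorWeilHodgeClassTwistedCarriers hC hDoor hK h633 hE₀ hone,
    andreSplitWeilClasses_of_oneTensorWeilHodgeClassTwistedCarriers hC hDoor h633 hE₀ hone⟩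

/-- **`HC_AV ⟸ K-C ∧ TwistedPerfectDoor ∧ Kodaira ∧ AndreCMAnchoredPencil ∧ andre1996_splitWeilClasses_weilLinePencil ∧ CMAlgebraicTwistedCarriers ∧ (ONE elliptic curve E₀) ∧
OneTensorWeilHodgeClassTwistedCarriers E₀`** — THE ANDRÉ COLUMN'S `B_min` OF GEN 61 WITH ONE ANDRÉ FACT BESIDES THE BINDER #21 (`HC_CM` IDLE; 6.3.2 kernel via CorCM; Kodaira by name).
[cite: Andre1996Motifs, §6.3 (pp. 31–33)] [cite: Andre1992HodgeCM, Théorème] [cite: Huybrechts2005, Prop. 5.3.1, Cor. 5.3.3] [cite: Bloch1972Semiregularity, Remark (7.5)] -/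
theorem HC_AV_of_kodaira_of_cmAlgebraic_and_oneTensorWeilHodgeClass_twistedCarriers (hC : VHCAbelianSchemesRoad.ChernCharacterOnBetti)
    (hDoor : VHCAbelianSchemesRoad.TwistedPerfectDoor) (hK : Kodaira1954_rationalKaehlerClass_eq_hyperplaneClass) (h₂₁ : VHCAbelianSchemesRoad.AndreCMAnchoredPencil)
    (h633 : andre1996_splitWeilClasses_weilLinePencil) (hcm : CMAlgebraicTwistedCarriers) {E₀ : AbelianVariety ℂ} (hE₀ : E₀.dim = 1)
    (hone : OneTensorWeilHodgeClassTwistedCarriers E₀) : PadicSemiregularLift.HodgeAbelianVarieties := by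
  obtain ⟨C⟩ := (hC : Nonempty ChernCharacterBetti)
  exact fun A ↦ forall_hodgeConjectureFor_of_kodaira_of_andre1996_of_splitWeilLinePencil_of_door_of_cmAlgebraic_of_oneCarried hK h₂₁ h633
    ((twistedPerfectDoorVHC_iff_localVariationalHodgeFor C _).1 (hDoor C)) (fun n p h2 h4 ↦ hcm C n p h2 h4) hE₀ (hone C) A

/-- **Binder #22 ⟸ Kodaira ∧ Lemme 6.3.3 alone (line form)** (through the CM line fact and AD-d §0). [cite: Andre1996Motifs, §6.3 Lemmes 6.3.2–6.3.3 (pp. 32–33)]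
[cite: Andre1992HodgeCM, Théorème] -/
theorem andreAnchoredPencilsAlgebraic_of_kodaira_of_splitWeilLinePencil (hK : Kodaira1954_rationalKaehlerClass_eq_hyperplaneClass)
    (h633 : andre1996_splitWeilClasses_weilLinePencil) : VHCAbelianSchemesRoad.AndreAnchoredPencilsAlgebraic :=
  andreAnchoredPencilsAlgebraic_of_weilLinePencils (andre1996_cmHodgeClasses_weilLinePencils_of_kodaira_of_splitWeilLinePencil hK h633)

end Kodaira

/-! ## §7 (appended) The smallest open instance: quartic-CM split Weil eightfolds from ONE carried class per quartic structure on `E₀⁸` -/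

section Smallest

open Summit.HodgeConjecture.HodgeConjecture.Ring2.SemiregularRepresentatives
  (weilClassesField_le_algebraicClasses_of_isWeilLineAnchoredPencilFor_of_door_of_oneCarried)

variable {B : AbelianVariety ℂ} {η : B ⟶ B} {R : Polynomial ℤ} {e : ProjectiveEmbedding B.X} {a : complexBetti (projectiveSpace e.n ℂ) 2}

/-- **CODIMENSION-2 WEIL CLASSES OF EVERY SPLIT QUARTIC-CM WEIL EIGHTFOLD ⟸ K-C ∧ TwistedPerfectDoor ∧ andre1996_splitWeilClasses_weilLinePencil ∧
QuarticTensorEightfoldOneTwistedCarrier** — the column's smallest open instance in carrier form: for every `(B, η)` of Weil type relative to a QUARTIC CM field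
(`IsWeilTypeCM B η R 2 2`: `[E:ℚ] = 4`, `dim_E H¹ = 4`, `dim B = 8`) with an `E`-compatible split hyperplane class, `W_E(B) ⊗ ℂ ≤ algebraicClasses B.X 2`, granted ONE
carried non-zero rational codimension-2 Weil class per quartic CM-field structure (with a Hodge witness) and polarisation on the abelian eightfolds isogenous to powers of
SOME elliptic curve `E₀` (twisted door), the door's variational statement and Lemme 6.3.3 alone in line form. If `W_E(B)` has no non-zero rational class there is nothing
to prove; otherwise the LINE engine at dimension `8`. In print: «not known to be algebraic (nor Künneth-algebraic)» (André 2026 §4.4.4); the K3-partner habitat `Y × Z²`.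
[cite: Andre2026, §4.4.4] [cite: Andre1996Motifs, §6.3 a), Lemme 6.3.3 and proof (pp. 32–33)] [cite: Markman2025SecantRealMultiplication, §1.1]
[cite: MoonenZarhin1998WeilClasses, §1] [cite: Bloch1972Semiregularity, Remark (7.5)] -/
theorem weilClassesField_le_algebraicClasses_quarticSplitEightfold_of_quarticTensorEightfoldOneTwistedCarrier
    (hC : VHCAbelianSchemesRoad.ChernCharacterOnBetti) (hDoor : VHCAbelianSchemesRoad.TwistedPerfectDoor) (h633 : andre1996_splitWeilClasses_weilLinePencil)
    (hQ : QuarticTensorEightfoldOneTwistedCarrier) (hB : IsWeilTypeCM B η R 2 2) (ha : IsRationalClass a) (ha₀ : a ≠ 0)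
    (hRos : ∀ x y : complexBetti B.X 1,
      polarizationPairingOne B.X (complexBetti.map e.ι 2 a) (B.dim - 1) (pullbackOne B η x) y =
        -polarizationPairingOne B.X (complexBetti.map e.ι 2 a) (B.dim - 1) x (pullbackOne B η y))
    (hsplit : IsHyperbolicWeilType B η (2 * 2) (complexBetti.map e.ι 2 a)) :
    weilClassesField B η (R.comp (Polynomial.X ^ 2)) (2 * 2) ≤ algebraicClasses B.X 2 := by
  obtain ⟨C⟩ := (hC : Nonempty ChernCharacterBetti)
  obtain ⟨E₀, hE₀, hcell⟩ := hQ
  have hT := (twistedPerfectDoorVHC_iff_localVariationalHodgeFor C _).1 (hDoor C)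
  have hdim : B.dim = 8 := by rw [hB.dim_eq]
  by_cases h0 : ∃ w ∈ weilClassesField B η (R.comp (Polynomial.X ^ 2)) (2 * 2), IsRationalClass w ∧ w ≠ 0
  swap
  · exact hB.weilClassesField_le_algebraicClasses_of_forall_isRationalClass fun w hw hwQ ↦ by
      have hw0 : w = 0 := by
        by_contra hne
        exact h0 ⟨w, hw, hwQ, hne⟩
      rw [hw0]
      exact zero_mem _
  obtain ⟨w, hw, hwQ, hw0⟩ := h0
  obtain ⟨𝒳, S, f, hf⟩ := h633 E₀ hE₀ R 2 2 (by norm_num) 1 (fun _ => B) (fun _ => η) (fun _ => e) (fun _ => a) (fun _ => w)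
    (fun _ => hB) (fun _ => ⟨ha, ha₀⟩) (fun _ => hRos) (fun _ => hsplit) (fun _ => hw) (fun _ => hwQ)
  have key := weilClassesField_le_algebraicClasses_of_isWeilLineAnchoredPencilFor_of_door_of_oneCarried (E₀ := E₀) hT hB hw0 (hf 0)
  rw [hdim] at key
  exact key (hcell C)

end Smallest

end Summit.HodgeConjecture.HodgeConjecture.Ring2.AbelianAll

end
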